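import Summits.CriticalPhenomena.PercolationContinuityZ3.Theses.PercNearOneGluing
import Literature.Probability.Percolation.PercolationProofs
import Literature.Probability.Percolation.ConditionalPositiveAssociationProofs
import Literature.Probability.Percolation.TwoClusterConditionalAssociationProofs
import Summits.CriticalPhenomena.PercolationContinuityZ3.Theorems.PercNearOneGluingAdditiveGluingGoodStep

/-! TTRL-lite variant V2086 of stmt-CriticalPhenomena-4576 -/

namespace Summit.CriticalPhenomena.PercolationContinuityZ3.Theorems

open MeasureTheory Literature.Probability.LatticeModels Literature.Probability.Percolation
open scoped Classical BigOperators

/-- TTRL-lite variant V2086 of `stub_goodStep` (stmt-CriticalPhenomena-4576): the inductive step of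
the good-quadruple (additive gluing) induction on `Fin 6` with a relay set of exactly four elements.
Since `o ∉ A` and `A.card = 4`, at most one vertex of `Fin 6` lies outside `A ∪ {o}`, so the
observer `o` has at most one low neighbour and the step is the unconditional special case
`goodStep_of_atMostOneLowNeighbour` (Kozma–Nitzan Theorem 5, penalised selection form); the
non-degeneracy hypothesis is not needed. -/
theorem stub_goodStep_var2086 :
    ∀ (w : Sym2 (Fin 6) → unitInterval) (A : Finset (Fin 6)) (o b : Fin 6), A.card = 4 → b ∈ A → o ∉ A → (∃ y : Fin 6, y ∉ A ∧ y ≠ o ∧ (w s(o, y) : ℝ) ≠ 0) → (∀ w' : Sym2 (Fin 6) → unitInterval, (Finset.univ.filter (fun v : Fin 6 => ∃ u : Fin 6, 0 < (w' s(u, v) : ℝ))).card < (Finset.univ.filter (fun v : Fin 6 => ∃ u : Fin 6, 0 < (w s(u, v) : ℝ))).card → ∀ (A' : Finset (Fin 6)) (o' b' : Fin 6), b' ∈ A' → o' ∉ A' → ∀ (t : ℝ) (sel : Finset (Fin 6) → Fin 6), (∀ W, sel W ∈ A') → (∀ a ∈ A', 1 - t ≤ (prodBernoulli w').real (openConn a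 b')) → (prodBernoulli w').real ((⋃ a ∈ A', openConn o' a) ∩ (openConn o' b')ᶜ) + ∑ W ∈ (Finset.univ : Finset (Finset (Fin 6))).filter (fun W => o' ∈ W ∧ Disjoint W A'), (prodBernoulli w').real {ω : BondConfig (Fin 6) | openCluster ω o' = (W : Set (Fin 6))} * (prodBernoulli w').real (openConnIn ((W : Set (Fin 6))ᶜ) (sel W) b')ᶜ ≤ t) → ∀ (t : ℝ) (sel : Finset (Fin 6) → Fin 6), (∀ W, sel W ∈ A) → (∀ a ∈ A, 1 - t ≤ (prodBernoulli w).real (openConn a b)) → (prodBernoulli w).real ((⋃ a ∈ A, openConn o a) ∩ (openConn o b)ᶜ) + ∑ W ∈ (Finset.univ : Finset (Finset (Fin 6))).filter (fun W => o ∈ W ∧ Disjoint W A), (prodBernoulli w).real {ω : BondConfig (Fin 6) | openCluster ω o = (W : Set (Fin 6))} * (prodBernoulli w).real (openConnIn ((W : Set (Fin 6))ᶜ) (sel W) b)ᶜ ≤ t := by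
  intro w A o b hcard hbA hoA _ ih
  refine goodStep_of_atMostOneLowNeighbour 6 w A o b hbA hoA ?_ ih
  intro y y' hyA hyo _ hy'A hy'o _
  by_contra hne
  have hy' : y' ∉ insert o A := by simp [hy'o, hy'A]
  have hy : y ∉ insert y' (insert o A) := by simp [hne, hyo, hyA]
  have hle : (insert y (insert y' (insert o A))).card ≤ 6 := by
    calc (insert y (insert y' (insert o A))).card ≤ (Finset.univ : Finset (Fin 6)).card :=
          Finset.card_le_univ _
      _ = 6 := Finset.card_fin 6
  rw [Finset.card_insert_of_notMem hy, Finset.card_insert_of_notMem hy',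
    Finset.card_insert_of_notMem hoA, hcard] at hle
  omega

end Summit.CriticalPhenomena.PercolationContinuityZ3.Theorems
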